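import Literature.NumberTheory.Automorphic.UnitaryCurveCohCotangentFormsContinuous
import Literature.NumberTheory.Automorphic.UnitaryGroupArchSection
import Literature.NumberTheory.Automorphic.UnitaryGroupLevelTransport
import Summits.HodgeConjecture.HodgeConjecture.Theorems.H413SpectrumJunction
import Mathlib.Analysis.InnerProductSpace.Continuous
import HarnessLib

/-!
# Crux `HLiu418`, K-lane E₂ — the DENSITY / IRREDUCIBILITY step (S2β₂) of the rank-2 orthogonality bootstrap for the named fact
# `UnitaryCurveForms.cohIsotypicLine₂_hol`, PROVED over the chart-free cone carriers

Cell `hodgecm-mathlib`, FLOOR 0, programme P5 (`F0_AlbCm`); crux item `stmt-HodgeConjecture-24832` (`HCCMUnconditional.HLiu418`); seat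
F0P5-p02 (g2), `--supports stmt-HodgeConjecture-24832` (helper).  THEOREMS ONLY — no definition, no instance, no notation, no named-fact
hypothesis, no `sorry`.  Rank-2 SCALAR twin of ★ `Theorems/F0P2aStubDensity` (F0P2a-p05; the S2β stub of the rank-3 line
`Cruxes/H413/Lines/F0_P2aCohIsotypicLine`, which closed ★ `CotangentForms.cohIsotypicLine_hol`).

## What is proved
* §1 (any unitary datum `U(J)`, `J ∈ M₂(E)`, `c ≠ 1` fixing the infinite places, ONE complex place `w₁`, a cone frame `𝔣` at `w₁`): the
  `(1,0) ⊕ (0,1)` cone cotangent forms ★ `UnitaryCurveForms.cohForms₂ … 𝔣` are left-`U(J)(F)`-invariant and right-invariant under the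
  archimedean factor `K_c = (ker archAt w₁).map archToAdelic` AWAY from `w₁`.
* §2 **`eq_zero_of_archOrth₂`** — for a discrete automorphic representation `P`, a NON-ZERO `U(J)(𝔸_{F,f})`-stable space `N` of
  cohomological cone cotangent forms contained in `P` (★ `ContainsFun`) and a cohomological cone cotangent form `f₃` contained in `P`: if every
  archimedean translate `R(adelicSingle w₁ u)[f]` (`u ∈ U(σ_{w₁}J)(ℂ)`) of the class of every `f ∈ N` is orthogonal to `[f₃]`, then `f₃ = 0`.
  Proof (= the rank-3 proof, one coordinate): `W = {v ∈ P ∣ ∀ x, ⟪R(x) v, [f₃]⟫ = 0}` is a CLOSED `R`-INVARIANT subspace of `P`; by the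
  UNCONDITIONAL product decomposition `x = adelicSingle w₁ u · k · (1, g)` (★ `exists_eq_adelicSingle_mul_kerArchAt_mul_finAdelicToAdelic`, no
  definiteness needed), right `K_c`-invariance and `U(J)(𝔸_{F,f})`-stability of `N` (transport ★ `SpectrumJunction.toLp_toQuotFun_mul_right`) it
  contains the classes of `N`, one of which is non-zero (★ `toLp_toQuotFun_ne_zero` with the UNCONDITIONAL continuity ★
  `UnitaryCurveForms.continuous_of_mem_cohForms₂`, `μ` positive on opens); topological irreducibility of `P` (★ `isTopIrreducible_iff`) gives
  `W = P ∋ [f₃]`, so `⟪[f₃],[f₃]⟫ = 0`, and continuity again gives `f₃ = 0` ([BorelJacquet1979, §4.6]; [GelfandGraevPiatetskiShapiro1969, Ch. 1 §2.3]).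
* §3 **`density₂_holds`** — the CM specialisation in the binder prefix of the letter `UnitaryCurveForms.cohIsotypicLine₂_hol` TOKEN FOR TOKEN
  (`L` CM, `ι`, `H`, frame `(dV, t, g)`, signature, definiteness, `4 ≤ [L:ℚ]`, `𝔣`, `μ`), `N ≤ holCotForms₂`, `f₃ ∈ holCotForms₂` — the body of
  the K-E₂ cut statement `DensityType₂` (HOME `F0/P5/p02/KE2/`), so a registered sub-line folds `stub_density₂ := E2Density.density₂_holds` by `δ`.

HONEST LABEL: HC_CM is proved only modulo the 7 printed citations until rung 0 closes; this file discharges none of them.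

## References
* [BorelJacquet1979] A. Borel, H. Jacquet, *Automorphic forms and automorphic representations*, PSPM 33.1 (1979), §4.1 (`G(𝔸) = G_∞ × G(𝔸_f)`),
  §4.2, §4.6 (the discrete spectrum).
* [GelfandGraevPiatetskiShapiro1969] I. M. Gelfand, M. I. Graev, I. I. Piatetski-Shapiro, *Representation theory and automorphic functions*
  (1969), Ch. 1 §2.3 (closed invariant subspaces of `L²` of a compact quotient).
* [PlatonovRapinchuk1994] V. Platonov, A. Rapinchuk, *Algebraic groups and number theory* (1994), §5.1.
* Tree: ★ `Theorems/H413SpectrumJunction` (`toLp_toQuotFun_mul_right`, `toLp_toQuotFun_ne_zero`, `quotientSubgroup_adelicGroupData`), ★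
  `Automorphic/UnitaryCurveCohCotangentForms(Continuous)` (carriers; continuity), ★ `Automorphic/UnitaryGroupArchFactor` (product decomposition),
  ★ `Automorphic/HilbertRepSpectrum` (`ClosedSubrep`, `isTopIrreducible_iff`).
-/

set_option autoImplicit false
-- the mandated namespace has the single-problem summit's repeated segment (`HodgeConjecture.HodgeConjecture`)
set_option linter.dupNamespace false

noncomputable section

namespace Summit.HodgeConjecture.HodgeConjecture.Cruxes.HLiu418.E2Density

open MeasureTheory NumberField NumberField.InfinitePlace Topology
open scoped InnerProductSpace ENNReal ComplexOrder Matrix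
open Literature.NumberTheory.Automorphic Literature.NumberTheory.Automorphic.UnitaryGroup
open Literature.NumberTheory.Automorphic.UnitaryGroup.CotangentForms (toQuotFun)
open Literature.NumberTheory.Automorphic.UnitaryCurveForms
open Summit.HodgeConjecture.HodgeConjecture.Cruxes.H413.SpectrumJunction

/-! ## §1 Left-invariance and right `K_c`-invariance of the cone cotangent forms; the regular representation on right-invariant classes -/

section Invariance

variable {F E : Type} [Field F] [NumberField F] [Field E] [NumberField E] [Algebra F E]
  {c : E ≃ₐ[F] E} {J : Matrix (Fin 2) (Fin 2) E}
  {hc : c ≠ 1} {hfix : ∀ w : InfinitePlace E, c • w = w} {w₁ : {w : InfinitePlace E // IsComplex w}} {𝔣 : ConeFrame E J w₁}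

/-- Cone-holomorphic cotangent forms are left-`A_G · U(J)(F)`-invariant (`A_G = 1`: ★ `quotientSubgroup_adelicGroupData`; clause (L) of ★
`holCotForms₂`). [cite: BorelJacquet1979, §4.2] -/
theorem leftInvariant_of_mem_holCotForms₂ {f : (adelicGroupData F E c 2 J).Adelic → ℂ} (hf : f ∈ holCotForms₂ F E c J hc hfix w₁ 𝔣) :
    ∀ γ ∈ (adelicGroupData F E c 2 J).quotientSubgroup, ∀ x, f (γ * x) = f x := by
  intro γ hγ x
  rw [quotientSubgroup_adelicGroupData] at hγ
  obtain ⟨γ₀, rfl⟩ := hγ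
  exact ((mem_holCotForms₂_iff F E c J hc hfix w₁ 𝔣 f).1 hf).1 γ₀ x

/-- Cohomological (`(1,0) ⊕ (0,1)`) cone cotangent forms are left-`A_G · U(J)(F)`-invariant. [cite: BorelJacquet1979, §4.2]
[cite: BorelWallach2000, VII 2.10] -/
theorem leftInvariant_of_mem_cohForms₂ {f : (adelicGroupData F E c 2 J).Adelic → ℂ} (hf : f ∈ cohForms₂ F E c J hc hfix w₁ 𝔣) :
    ∀ γ ∈ (adelicGroupData F E c 2 J).quotientSubgroup, ∀ x, f (γ * x) = f x := by
  intro γ hγ x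
  obtain ⟨a, ha, b, hb, rfl⟩ := Submodule.mem_sup.1 hf
  obtain ⟨b', hb', rfl⟩ := Submodule.mem_map.1 hb
  simp only [Pi.add_apply, conjFun₂_apply, leftInvariant_of_mem_holCotForms₂ ha γ hγ x, leftInvariant_of_mem_holCotForms₂ hb' γ hγ x]

/-- Cone-holomorphic cotangent forms are right-invariant under the archimedean factor `K_c(w₁)` away from `w₁` (clause (Kc) of ★ `holCotForms₂`).
[cite: BorelJacquet1979, §4.2] -/
theorem apply_mul_of_mem_holCotForms₂ {f : (adelicGroupData F E c 2 J).Adelic → ℂ} (hf : f ∈ holCotForms₂ F E c J hc hfix w₁ 𝔣)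
    {k : (adelicGroupData F E c 2 J).Adelic} (hk : k ∈ ((archAt F E c 2 J w₁ (hfix w₁.1) hc).ker).map (archToAdelic F E c 2 J))
    (x : (adelicGroupData F E c 2 J).Adelic) : f (x * k) = f x :=
  ((mem_holCotForms₂_iff F E c J hc hfix w₁ 𝔣 f).1 hf).2.1 k hk x

/-- Cohomological cone cotangent forms are right-`K_c(w₁)`-invariant. [cite: BorelJacquet1979, §4.2] [cite: BorelWallach2000, VII 2.10] -/
theorem apply_mul_of_mem_cohForms₂ {f : (adelicGroupData F E c 2 J).Adelic → ℂ} (hf : f ∈ cohForms₂ F E c J hc hfix w₁ 𝔣)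
    {k : (adelicGroupData F E c 2 J).Adelic} (hk : k ∈ ((archAt F E c 2 J w₁ (hfix w₁.1) hc).ker).map (archToAdelic F E c 2 J))
    (x : (adelicGroupData F E c 2 J).Adelic) : f (x * k) = f x := by
  obtain ⟨a, ha, b, hb, rfl⟩ := Submodule.mem_sup.1 hf
  obtain ⟨b', hb', rfl⟩ := Submodule.mem_map.1 hb
  simp only [Pi.add_apply, conjFun₂_apply, apply_mul_of_mem_holCotForms₂ ha hk x, apply_mul_of_mem_holCotForms₂ hb' hk x]

end Invariance

section Classes

variable {K : Type} [Field K] [NumberField K] {𝒢 : AdelicGroupData.{0} K}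
  {μ : Measure 𝒢.automorphicQuotient} [SMulInvariantMeasure 𝒢.Adelic 𝒢.automorphicQuotient μ]

/-- **`R(k)` fixes the class of a right-`k`-invariant scalar form**: for `f` left-`A_G·G(K)`-invariant with `f (x k) = f x` and `[f] ∈ L²`,
`R(k) [f] = [f]` (★ `toLp_toQuotFun_mul_right` at a fixed vector). [cite: BorelJacquet1979, §4.6] -/
theorem rightRegular_toLp_of_apply_mul {f : 𝒢.Adelic → ℂ} (hleft : ∀ γ ∈ 𝒢.quotientSubgroup, ∀ g, f (γ * g) = f g)
    (k : 𝒢.Adelic) (hk : ∀ x, f (x * k) = f x) (hmem : MemLp (toQuotFun 𝒢 f) 2 μ) :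
    𝒢.rightRegular μ k (hmem.toLp (toQuotFun 𝒢 f)) = hmem.toLp (toQuotFun 𝒢 f) := by
  have hfun : (fun x => f (x * k)) = f := funext hk
  have hmemk : MemLp (toQuotFun 𝒢 fun x => f (x * k)) 2 μ := by
    rw [hfun]
    exact hmem
  rw [← toLp_toQuotFun_mul_right hleft k hmem hmemk]
  exact MemLp.toLp_congr _ _ (Filter.EventuallyEq.of_eq (by rw [hfun]))

end Classes

/-! ## §2 The density / irreducibility step for a general rank-2 unitary datum (chart-free archimedean factor at `w₁`) -/

section Generic

variable {F E : Type} [Field F] [NumberField F] [Field E] [NumberField E] [Algebra F E]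
  {c : E ≃ₐ[F] E} {J : Matrix (Fin 2) (Fin 2) E}
  (hc : c ≠ 1) (hfix : ∀ w : InfinitePlace E, c • w = w) (w₁ : {w : InfinitePlace E // IsComplex w}) (𝔣 : ConeFrame E J w₁)
  {μ : Measure (adelicGroupData F E c 2 J).automorphicQuotient} [(adelicGroupData F E c 2 J).IsAutomorphicMeasure μ]

/-- **S2β₂, generic form — density / irreducibility for cone cotangent forms.**  `P` a discrete automorphic representation of `U(J)`; `N` a
NON-ZERO `U(J)(𝔸_{F,f})`-stable space of `(1,0) ⊕ (0,1)` cone cotangent forms at `(w₁, 𝔣)` contained in `P`; `f₃` a cohomological cone cotangent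
form contained in `P`.  If `⟪R(adelicSingle w₁ u)[f], [f₃]⟫ = 0` for all `f ∈ N` and `u ∈ U(σ_{w₁}J)(ℂ)`, then `f₃ = 0`: the closed `R`-invariant
subspace `{v ∈ P ∣ ∀ x, ⟪R(x) v, [f₃]⟫ = 0}` contains the (non-zero) classes of `N` — `R(adelicSingle w₁ u · k · (1,g))[f] = R(adelicSingle w₁ u)[R_g f]`
by right `K_c`-invariance and the transport identity — hence is all of the topologically irreducible `P ∋ [f₃]`; so `[f₃] = 0` and, `f₃` being
continuous and `μ` positive on open sets, `f₃ = 0`. [cite: BorelJacquet1979, §4.1 and §4.6] [cite: GelfandGraevPiatetskiShapiro1969, Ch. 1 §2.3] -/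
theorem eq_zero_of_archOrth₂ (P : DiscreteAutomorphicRep (adelicGroupData F E c 2 J) μ)
    (N : Submodule ℂ ((adelicGroupData F E c 2 J).Adelic → ℂ)) (hN : N ≤ cohForms₂ F E c J hc hfix w₁ 𝔣)
    (hNP : ∀ f ∈ N, P.ContainsFun f) (hNst : ∀ (k : finAdelic F E c 2 J), ∀ f ∈ N, rightRep₂ F E c J k f ∈ N) (hN0 : N ≠ ⊥)
    (f₃ : (adelicGroupData F E c 2 J).Adelic → ℂ) (hf₃ : f₃ ∈ cohForms₂ F E c J hc hfix w₁ 𝔣) (hP₃ : P.ContainsFun f₃)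
    (horth : ∀ f ∈ N, ∀ (hf : MemLp (toQuotFun (adelicGroupData F E c 2 J) f) 2 μ)
        (h₃ : MemLp (toQuotFun (adelicGroupData F E c 2 J) f₃) 2 μ), ∀ u : archLocal E 2 J w₁,
      ⟪(adelicGroupData F E c 2 J).rightRegular μ (adelicSingle F E c 2 J hc hfix w₁ u) (hf.toLp (toQuotFun (adelicGroupData F E c 2 J) f)),
        h₃.toLp (toQuotFun (adelicGroupData F E c 2 J) f₃)⟫_ℂ = 0) :
    f₃ = 0 := by
  have h₃ : MemLp (toQuotFun (adelicGroupData F E c 2 J) f₃) 2 μ := hP₃.choose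
  have h₃P : h₃.toLp (toQuotFun (adelicGroupData F E c 2 J) f₃) ∈ P.space.toSubmodule := hP₃.choose_spec
  -- it suffices that the CLASS of `f₃` vanishes (continuity, measure positive on opens)
  suffices hcls : h₃.toLp (toQuotFun (adelicGroupData F E c 2 J) f₃) = 0 by
    by_contra hne
    exact toLp_toQuotFun_ne_zero (leftInvariant_of_mem_cohForms₂ hf₃) (continuous_of_mem_cohForms₂ F E c J hc hfix w₁ 𝔣 hf₃) h₃ hne hcls
  set d : (adelicGroupData F E c 2 J).L2 μ := h₃.toLp (toQuotFun (adelicGroupData F E c 2 J) f₃) with hd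
  have hdP : d ∈ P.space.toSubmodule := h₃P
  -- the closed `R`-invariant subspace `W = {v ∈ P ∣ ∀ x, ⟪R(x) v, d⟫ = 0}` of `P`
  let W : ContRepresentation.ClosedSubrep P.space.toContRep :=
    { toSubmodule :=
        { carrier := {v : P.space.toSubmodule |
            ∀ x : (adelicGroupData F E c 2 J).Adelic, ⟪(adelicGroupData F E c 2 J).rightRegular μ x (v : (adelicGroupData F E c 2 J).L2 μ), d⟫_ℂ = 0}
          add_mem' := fun {a b} ha hb x => by
            simp only [Submodule.coe_add, map_add, inner_add_left, ha x, hb x, add_zero]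
          zero_mem' := fun x => by
            simp only [Submodule.coe_zero, map_zero, inner_zero_left]
          smul_mem' := fun r a ha x => by
            simp only [Submodule.coe_smul, map_smul, inner_smul_left, ha x, mul_zero] }
      apply_mem_toSubmodule := fun g a ha x => by
        show ⟪(adelicGroupData F E c 2 J).rightRegular μ x
          ((P.space.toContRep g a : P.space.toSubmodule) : (adelicGroupData F E c 2 J).L2 μ), d⟫_ℂ = 0
        rw [ContRepresentation.ClosedSubrep.coe_toContRep_apply, ← mul_apply_eq_comp, ← map_mul]
        exact ha (x * g)
      isClosed' := by
        show IsClosed {v : P.space.toSubmodule |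
            ∀ x : (adelicGroupData F E c 2 J).Adelic, ⟪(adelicGroupData F E c 2 J).rightRegular μ x (v : (adelicGroupData F E c 2 J).L2 μ), d⟫_ℂ = 0}
        have hset : {v : P.space.toSubmodule | ∀ x : (adelicGroupData F E c 2 J).Adelic,
              ⟪(adelicGroupData F E c 2 J).rightRegular μ x (v : (adelicGroupData F E c 2 J).L2 μ), d⟫_ℂ = 0} =
            ⋂ x : (adelicGroupData F E c 2 J).Adelic, {v : P.space.toSubmodule |
              ⟪(adelicGroupData F E c 2 J).rightRegular μ x (v : (adelicGroupData F E c 2 J).L2 μ), d⟫_ℂ = 0} := by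
          ext v
          simp only [Set.mem_setOf_eq, Set.mem_iInter]
        rw [hset]
        refine isClosed_iInter fun x => isClosed_eq ?_ continuous_const
        exact (((adelicGroupData F E c 2 J).rightRegular μ x).continuous.comp continuous_subtype_val).inner continuous_const }
  have memW : ∀ v : P.space.toSubmodule, v ∈ W ↔
      ∀ x : (adelicGroupData F E c 2 J).Adelic, ⟪(adelicGroupData F E c 2 J).rightRegular μ x (v : (adelicGroupData F E c 2 J).L2 μ), d⟫_ℂ = 0 :=
    fun v => Iff.rfl
  -- the classes of `N` lie in `W`
  have hclsW : ∀ f ∈ N, ∀ (hf : MemLp (toQuotFun (adelicGroupData F E c 2 J) f) 2 μ)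
      (hfP : hf.toLp (toQuotFun (adelicGroupData F E c 2 J) f) ∈ P.space.toSubmodule),
      (⟨hf.toLp (toQuotFun (adelicGroupData F E c 2 J) f), hfP⟩ : P.space.toSubmodule) ∈ W := by
    intro f hfN hf hfP
    rw [memW]
    intro x
    obtain ⟨u, k, g, hk, rfl⟩ := exists_eq_adelicSingle_mul_kerArchAt_mul_finAdelicToAdelic F E c 2 J hc hfix w₁ x
    rw [map_mul, map_mul, mul_apply_eq_comp, mul_apply_eq_comp]
    -- `R(1, g) [f] = [R_g f]`, with `R_g f ∈ N`
    have hgN : rightRep₂ F E c J g f ∈ N := hNst g f hfN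
    have hgmem : MemLp (toQuotFun (adelicGroupData F E c 2 J) (rightRep₂ F E c J g f)) 2 μ := (hNP _ hgN).choose
    have hfun : (toQuotFun (adelicGroupData F E c 2 J) (rightRep₂ F E c J g f)) =
        toQuotFun (adelicGroupData F E c 2 J) fun x => f (x * finAdelicToAdelic F E c 2 J g) := by
      funext y
      simp only [toQuotFun, rightRep₂_apply]
    have hmemh : MemLp (toQuotFun (adelicGroupData F E c 2 J) fun x => f (x * finAdelicToAdelic F E c 2 J g)) 2 μ :=
      hfun ▸ hgmem
    have h1 : (adelicGroupData F E c 2 J).rightRegular μ (finAdelicToAdelic F E c 2 J g)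
          (hf.toLp (toQuotFun (adelicGroupData F E c 2 J) f)) =
        hgmem.toLp (toQuotFun (adelicGroupData F E c 2 J) (rightRep₂ F E c J g f)) := by
      rw [← toLp_toQuotFun_mul_right (leftInvariant_of_mem_cohForms₂ (hN hfN)) _ hf hmemh]
      exact MemLp.toLp_congr _ _ (Filter.EventuallyEq.of_eq hfun.symm)
    rw [h1]
    -- `R(k) [R_g f] = [R_g f]` by right `K_c`-invariance of cohomological forms
    rw [rightRegular_toLp_of_apply_mul (leftInvariant_of_mem_cohForms₂ (hN hgN)) k
      (fun x => apply_mul_of_mem_cohForms₂ (hN hgN) hk x) hgmem]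
    -- the archimedean translate is orthogonal to `d` by hypothesis
    exact horth _ hgN hgmem h₃ u
  -- a non-zero class of `N` (so `W ≠ ⊥`)
  obtain ⟨f, hfN, hfne⟩ := (Submodule.ne_bot_iff N).mp hN0
  have hfmem : MemLp (toQuotFun (adelicGroupData F E c 2 J) f) 2 μ := (hNP f hfN).choose
  have hfmemP : hfmem.toLp (toQuotFun (adelicGroupData F E c 2 J) f) ∈ P.space.toSubmodule := (hNP f hfN).choose_spec
  have hvne : hfmem.toLp (toQuotFun (adelicGroupData F E c 2 J) f) ≠ 0 :=
    toLp_toQuotFun_ne_zero (leftInvariant_of_mem_cohForms₂ (hN hfN)) (continuous_of_mem_cohForms₂ F E c J hc hfix w₁ 𝔣 (hN hfN)) hfmem hfne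
  have hvW := hclsW f hfN hfmem hfmemP
  -- topological irreducibility of `P`: `W = ⊥` or `W = ⊤`
  obtain ⟨-, hsimple⟩ := (ContRepresentation.isTopIrreducible_iff _).mp P.irreducible
  rcases hsimple W with hbot | htop
  · exfalso
    rw [hbot, ContRepresentation.ClosedSubrep.mem_bot] at hvW
    exact hvne (congrArg Subtype.val hvW)
  · have hdW : (⟨d, hdP⟩ : P.space.toSubmodule) ∈ W := by
      rw [htop]
      exact ContRepresentation.ClosedSubrep.mem_top _
    have h0 := (memW _).mp hdW 1
    rw [map_one, one_apply_eq_self] at h0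
    exact inner_self_eq_zero.mp h0

/-- **S2β₂ for cone-HOLOMORPHIC forms** (`holCotForms₂ ≤ cohForms₂`): the form used by the K-E₂ cut. [cite: BorelJacquet1979, §4.6]
[cite: GelfandGraevPiatetskiShapiro1969, Ch. 1 §2.3] -/
theorem eq_zero_of_archOrth₂_hol (P : DiscreteAutomorphicRep (adelicGroupData F E c 2 J) μ)
    (N : Submodule ℂ ((adelicGroupData F E c 2 J).Adelic → ℂ)) (hN : N ≤ holCotForms₂ F E c J hc hfix w₁ 𝔣)
    (hNP : ∀ f ∈ N, P.ContainsFun f) (hNst : ∀ (k : finAdelic F E c 2 J), ∀ f ∈ N, rightRep₂ F E c J k f ∈ N) (hN0 : N ≠ ⊥)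
    (f₃ : (adelicGroupData F E c 2 J).Adelic → ℂ) (hf₃ : f₃ ∈ holCotForms₂ F E c J hc hfix w₁ 𝔣) (hP₃ : P.ContainsFun f₃)
    (horth : ∀ f ∈ N, ∀ (hf : MemLp (toQuotFun (adelicGroupData F E c 2 J) f) 2 μ)
        (h₃ : MemLp (toQuotFun (adelicGroupData F E c 2 J) f₃) 2 μ), ∀ u : archLocal E 2 J w₁,
      ⟪(adelicGroupData F E c 2 J).rightRegular μ (adelicSingle F E c 2 J hc hfix w₁ u) (hf.toLp (toQuotFun (adelicGroupData F E c 2 J) f)),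
        h₃.toLp (toQuotFun (adelicGroupData F E c 2 J) f₃)⟫_ℂ = 0) :
    f₃ = 0 :=
  eq_zero_of_archOrth₂ hc hfix w₁ 𝔣 P N (fun _ hf => holCotForms₂_le_cohForms₂ F E c J hc hfix w₁ 𝔣 (hN hf)) hNP hNst hN0 f₃
    (holCotForms₂_le_cohForms₂ F E c J hc hfix w₁ 𝔣 hf₃) hP₃ horth

end Generic

/-! ## §3 The CM specialisation in the letter's binder prefix: the body of the K-E₂ cut statement `DensityType₂`, by `δ` -/

/-- **`density₂_holds` — S2β₂ in the binder prefix of ★ `UnitaryCurveForms.cohIsotypicLine₂_hol` TOKEN FOR TOKEN** (the frame, signature,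
definiteness and degree binders are carried but unused: the product decomposition and the continuity of cone forms are unconditional).  This is
the body of the K-E₂ cut statement `DensityType₂`. [cite: BorelJacquet1979, §4.1 and §4.6] [cite: GelfandGraevPiatetskiShapiro1969, Ch. 1 §2.3] -/
theorem density₂_holds :
    ∀ (L : Type) [Field L] [NumberField L] [IsCMField L] (ι : L →+* ℂ) (H : Matrix (Fin 2) (Fin 2) L)
    (dV : Fin 2 → L) (_hdV : ∀ i, IsCMField.complexConj L (dV i) = dV i) (_hdV0 : ∀ i, dV i ≠ 0)
    (t : L) (_ht : t ≠ 0) (g : GL (Fin 2) L),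
    formCongr ((IsCMField.complexConj L : L ≃ₐ[↥(maximalRealSubfield L)] L) : L →+* L) g (t • H) = Matrix.diagonal dV →
    (∃ T : GL (Fin 2) ℂ, formCongr (starRingEnd ℂ) T ((Matrix.diagonal dV).map ι) = Matrix.diagonal ![(1 : ℂ), -1]) →
    (∀ τ' : L →+* ℂ, InfinitePlace.mk τ' ≠ InfinitePlace.mk ι → ((Matrix.diagonal dV).map τ').PosDef) →
    4 ≤ Module.finrank ℚ L →
    ∀ (𝔣 : ConeFrame L H (cmPlace L ι))
      (μ : Measure (adelicGroupData (↥(maximalRealSubfield L)) L (IsCMField.complexConj L) 2 H).automorphicQuotient)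
      [(adelicGroupData (↥(maximalRealSubfield L)) L (IsCMField.complexConj L) 2 H).IsAutomorphicMeasure μ]
      (P : DiscreteAutomorphicRep (adelicGroupData (↥(maximalRealSubfield L)) L (IsCMField.complexConj L) 2 H) μ)
      (N : Submodule ℂ ((adelicGroupData (↥(maximalRealSubfield L)) L (IsCMField.complexConj L) 2 H).Adelic → ℂ)),
      N ≤ holCotForms₂ (↥(maximalRealSubfield L)) L (IsCMField.complexConj L) H (IsCMField.complexConj_ne_one L)
          (UnitaryGroup.complexConj_smul_infinitePlace L) (cmPlace L ι) 𝔣 →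
      (∀ f ∈ N, P.ContainsFun f) →
      (∀ (k : finAdelic (↥(maximalRealSubfield L)) L (IsCMField.complexConj L) 2 H), ∀ f ∈ N,
          rightRep₂ (↥(maximalRealSubfield L)) L (IsCMField.complexConj L) H k f ∈ N) →
      N ≠ ⊥ →
    ∀ f₃ ∈ holCotForms₂ (↥(maximalRealSubfield L)) L (IsCMField.complexConj L) H (IsCMField.complexConj_ne_one L)
        (UnitaryGroup.complexConj_smul_infinitePlace L) (cmPlace L ι) 𝔣,
      P.ContainsFun f₃ →
      (∀ f ∈ N, ∀ (hf : MemLp (toQuotFun (adelicGroupData (↥(maximalRealSubfield L)) L (IsCMField.complexConj L) 2 H) f) 2 μ)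
          (h₃ : MemLp (toQuotFun (adelicGroupData (↥(maximalRealSubfield L)) L (IsCMField.complexConj L) 2 H) f₃) 2 μ),
        ∀ u : archLocal L 2 H (cmPlace L ι),
          ⟪(adelicGroupData (↥(maximalRealSubfield L)) L (IsCMField.complexConj L) 2 H).rightRegular μ
              (adelicSingle (↥(maximalRealSubfield L)) L (IsCMField.complexConj L) 2 H (IsCMField.complexConj_ne_one L)
                (UnitaryGroup.complexConj_smul_infinitePlace L) (cmPlace L ι) u)
              (MemLp.toLp (toQuotFun (adelicGroupData (↥(maximalRealSubfield L)) L (IsCMField.complexConj L) 2 H) f) hf),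
            MemLp.toLp (toQuotFun (adelicGroupData (↥(maximalRealSubfield L)) L (IsCMField.complexConj L) 2 H) f₃) h₃⟫_ℂ = 0) →
      f₃ = 0 :=
  fun L _ _ _ ι _ _ _ _ _ _ _ _ _ _ _ 𝔣 _ _ P N hN hNP hNst hN0 f₃ hf₃ hP₃ horth =>
    eq_zero_of_archOrth₂_hol (IsCMField.complexConj_ne_one L) (UnitaryGroup.complexConj_smul_infinitePlace L) (cmPlace L ι) 𝔣 P N hN
      hNP hNst hN0 f₃ hf₃ hP₃ horth

end Summit.HodgeConjecture.HodgeConjecture.Cruxes.HLiu418.E2Density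

end
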